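import Literature.Topology.FourManifolds.FishtailTubeD
import Literature.Topology.FourManifolds.FishtailBoxCorner
import Literature.Topology.FourManifolds.FishtailLambda
import HarnessLib

/-!
# The fishtail end in `X^σ`: box shell, corner at the hole, and the tube about Gompf's disc

Infrastructure for the explicit fishtail neighbourhood (R. Gompf, *More Cappell–Shaneson spheres
are standard*, Algebr. Geom. Topol. 10 (2010), proof of Thm 2.1 (the box `N = I₀ × [0,1] × T²`)
and Lemma 2.2 (`Φ = N ∪_γ` 2-handle); the named fact
`Literature.Topology.FourManifolds.gompf2010_framedTwist`). On the second cylinder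
`T³ × (1/2, 3/2)` of the fishtail end model (depth `e` from `z₁`, vanishing-cycle angle `θ` from
`z₂`, fibre `z₃`, base `s`) the map into `X^σ` is, according to the distance
`ρ = |p₀|` from the hole `γ` (`p₀ = (n - n_j) + i (1 - e) h tan (2π(s - 1))`, `n = θ - θ₀ + n_j`):

* `ρ < r_h`: the tube about Gompf's disc at `Λ(p₀, z₃)` (`tubeD`, `FishtailTubeD.lean`; the
  handle identification `ζ = c p₀ e^{-iS′} z₃`, `w = W e^{iS′} z̄₃`, `FishtailLambda.lean`);
* `r_h ≤ ρ < r_c`: the corner (Gompf's bend `fishBend`, `FishtailBendV2.lean`), fibre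
  `z₃ · (p₀/|p₀|) · e^{-iS′(p₀)}`;
* `r_c ≤ ρ` (and `|s - 1| ≥ 1/5`): the shell of the box, fibre `z₃ · Tw(n, s)` with the
  clutching twist `Tw = e^{-2πi [s > 1] τ̂_w(n - n_j)}` running from the hole UP to the seam
  `s = 3/2`, where it is the model monodromy.

Here `S′(p₀) = capBlend (|p₀|) · (holeLift w (i p₀) - π/2)` is the smooth cut-off lift
(`FishtailHoleLift.lean`, evaluated at `i p₀` so that its branch strip runs up in `s`).
This file defines the three pieces and `Literature.Topology.FourManifolds.iotaTwo`, and proves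
the two agreements: corner = box in box mode (`cornerP_eq_boxP`), hole = corner in handle mode
(`holeP_eq_cornerP`, given the tube's leg window). Everything is proved; no named facts.

## References

* R. E. Gompf, *More Cappell–Shaneson spheres are standard*, Algebr. Geom. Topol. 10 (2010)
  1665–1681, proof of Thm 2.1 and Lemma 2.2. [GompfAGT2010]
-/

noncomputable section

open scoped Real ContDiff Topology Manifold
open Set Function Filter Complex Metric

namespace Literature.Topology.FourManifolds

local notation "𝔼 " n:arg => EuclideanSpace ℝ (Fin n)

/-! ### The data -/

/-- **The data of the fishtail end map**: the tube data, the model hole angle `θ₀`, the strip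
half-width `w`, the cut-off radii `rΛ₁ < rΛ₂` of the lift, the bend `p₁`, the maximal depth `E₁`,
the glue radii `r_h`, `r_c`. [folklore] -/
structure IotaData extends TubeDData where
  /-- the model angle of the hole -/ θ₀ : ℝ
  /-- half-width of the clutching strip -/ wS : ℝ
  /-- cut-off radii of the lift -/ rΛ₁ : ℝ
  rΛ₂ : ℝ
  /-- the bend parameter -/ p₁ : ℝ
  /-- the maximal depth of the model end -/ E₁ : ℝ
  /-- glue radii hole | corner | box -/ rh : ℝ
  rc : ℝ

namespace IotaData

variable (J : IotaData)

/-! ### Model coordinates -/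

/-- The depth `e = E₁ (1 - re z₁)/2 ∈ (0, E₁)` of a point of the upper half of the depth circle. [folklore] -/
def depth (z₁ : Circle) : ℝ := J.E₁ * (1 - (z₁ : ℂ).re) / 2

/-- The vanishing-cycle coordinate `n = arg z₂ - θ₀ + n_j`. [folklore] -/
def lat (z₂ : Circle) : ℝ := arg (z₂ : ℂ) - J.θ₀ + J.nj

/-- **The hole coordinate** `p₀ = (n - n_j) + i (1 - e) h tan (2π(s - 1))` (face-plane offset from the hole centre). [folklore] -/
def holeP0 (x : ThreeTorus) (s : ℝ) : ℂ :=
  ((J.lat x.2.1 - J.nj : ℝ) : ℂ) + (((1 - J.depth x.1) * bxH * Real.tan (2 * π * (s - 1)) : ℝ) : ℂ) * I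

/-- **The cut-off smooth lift** `S′(p) = capBlend (|p|) (holeLift w (i p) - π/2)`. [folklore] -/
def liftS (p : ℂ) : ℝ := capBlend J.rΛ₁ J.rΛ₂ ‖p‖ * (holeLift J.wS (I * p) - π / 2)

/-- The distance to the hole (`1` away from the face band). [folklore] -/
def holeDist (x : ThreeTorus) (s : ℝ) : ℝ := if |s - 1| < 1 / 5 then ‖J.holeP0 x s‖ else 1

/-! ### The box shell -/

/-- **The clutching twist of the box fibre**: `1` for `s ≤ 1`, `e^{-2πi τ̂_w(n - n_j)}` for `s > 1`. [folklore] -/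
def twistC (n s : ℝ) : Circle := if s ≤ 1 then 1 else Circle.exp (-(2 * π * stepW J.wS (n - J.nj)))

/-- **The box shell piece**: `T³`-point `(e^{in} f⁻¹, e^{iy}, f)`, `f = z₃ Tw`, at base `t = faceT`,
`y = faceY`, angle `thetaV s`, depth `e`. [folklore] -/
def boxP (x : ThreeTorus) (s : ℝ) : (fishNu J.hε J.hε2).Surgered :=
  toSurg (fishNu J.hε J.hε2) (mtPt tubeShearDiffeo
    (Circle.exp (J.lat x.2.1) * (x.2.2 * J.twistC (J.lat x.2.1) s)⁻¹,
      Circle.exp (faceY (thetaV s) (J.depth x.1)), x.2.2 * J.twistC (J.lat x.2.1) s)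
    (faceT (thetaV s) (J.depth x.1)))

/-! ### The corner -/

/-- The bent position and depth `(W, E) = fishBend c p₁ ρ_b (|p₀|, e)`. [folklore] -/
def bendWE (x : ThreeTorus) (s : ℝ) : ℝ × ℝ := fishBend J.cL J.p₁ J.ρbL (‖J.holeP0 x s‖, J.depth x.1)

/-- **The corner piece**: face-plane offset `W p₀/|p₀|`, base `1 + E h`, fibre `z₃ (p₀/|p₀|) e^{-iS′(p₀)}`. [folklore] -/
def cornerP (x : ThreeTorus) (s : ℝ) : (fishNu J.hε J.hε2).Surgered :=
  let p := J.holeP0 x s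
  let f : Circle := x.2.2 * unitC p * Circle.exp (-J.liftS p)
  toSurg (fishNu J.hε J.hε2) (mtPt tubeShearDiffeo
    (Circle.exp (J.nj + ((J.bendWE x s).1 : ℝ) * ((unitC p : ℂ)).re) * f⁻¹,
      Circle.exp (J.yh + ((J.bendWE x s).1 : ℝ) * ((unitC p : ℂ)).im), f)
    (1 + (J.bendWE x s).2 * bxH))

/-! ### The hole: the tube about Gompf's disc -/

/-- The disc coordinate `ζ = c p₀ e^{-iS′(p₀)} z₃`. [folklore] -/
def holeZeta (x : ThreeTorus) (s : ℝ) : ℂ :=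
  (J.cL : ℂ) * J.holeP0 x s * (Circle.exp (-J.liftS (J.holeP0 x s)) : ℂ) * (x.2.2 : ℂ)

/-- The normal offset `w = W e^{iS′(p₀)} z̄₃`. [folklore] -/
def holeW (x : ThreeTorus) (s : ℝ) : ℂ :=
  ((J.bendWE x s).1 : ℂ) * (Circle.exp (J.liftS (J.holeP0 x s)) : ℂ) * ((x.2.2⁻¹ : Circle) : ℂ)

/-- **The hole piece**: the tube about Gompf's disc at `(ζ, w)`. [folklore] -/
def holeP (x : ThreeTorus) (s : ℝ) : (fishNu J.hε J.hε2).Surgered :=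
  J.tubeD (J.holeZeta x s, (J.holeW x s).re, (J.holeW x s).im)

/-! ### The end map on the second cylinder -/

/-- **The fishtail end in `X^σ` on the second cylinder** (glued along the distance to the hole). [cite: GompfAGT2010, Lemma 2.2 (Φ = N ∪_γ h and the framed embedding of the fishtail neighbourhood)] -/
def iotaTwo (p : ThreeTorus × ℝ) : (fishNu J.hε J.hε2).Surgered :=
  glueBy (fun p : ThreeTorus × ℝ ↦ J.holeDist p.1 p.2) J.rh (fun p ↦ J.holeP p.1 p.2)
    (glueBy (fun p : ThreeTorus × ℝ ↦ J.holeDist p.1 p.2) J.rc (fun p ↦ J.cornerP p.1 p.2) fun p ↦ J.boxP p.1 p.2) p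

/-! ### Agreement of the corner with the box shell (box mode) -/

/-- The face point of the model point: on the flat sector `y = cY + (1 - e) h tan (2π(s-1))`,
`t = 1 + e h`. [folklore] -/
theorem face_flat {s : ℝ} (hs : |s - 1| ≤ 19 / 100) (e : ℝ) :
    faceY (thetaV s) e = cY + (1 - e) * bxH * Real.tan (2 * π * (s - 1)) ∧ faceT (thetaV s) e = 1 + e * bxH := by
  have hθ : |thetaV s - π / 2| ≤ bxPhi1 := by
    rw [thetaV, show π / 2 - 2 * π * (s - 1) - π / 2 = -(2 * π * (s - 1)) by ring, abs_neg, abs_mul,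
      abs_of_pos (by positivity : (0:ℝ) < 2 * π), bxPhi1]
    -- `2π · 0.19 ≤ arctan 3`: `arctan 3 > 1.2 > 2π·0.19 ≈ 1.194`
    have h3 : (6 : ℝ) / 5 < Real.arctan 3 := by
      -- `tan 1.2 < 3`: use `arctan` monotone with `tan (6/5) ≤ 3`? We bound via `arctan 3 ≥ π/2 - arctan (1/3)`
      -- and `arctan (1/3) ≤ 1/3`, `π > 3.14`: `π/2 - 1/3 > 1.23 > 1.2`.
      have hA : Real.arctan 3 = π / 2 - Real.arctan (1 / 3) := by
        rw [show (1:ℝ) / 3 = 3⁻¹ by norm_num, Real.arctan_inv_of_pos (by norm_num)]; ring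
      have hB : Real.arctan (1 / 3) < 1 / 3 := by
        have h0 : 0 < Real.arctan (1 / 3) := Real.arctan_pos.2 (by norm_num)
        have := Real.lt_tan h0 (Real.arctan_lt_pi_div_two _)
        rwa [Real.tan_arctan] at this
      rw [hA]; linarith [Real.pi_gt_d2]
    have hπ : π < 3.1416 := Real.pi_lt_d4
    nlinarith [abs_nonneg (s - 1)]
  refine ⟨?_, faceT_flat hθ e⟩
  rw [faceY_thetaV_eq_faceYs hθ, faceYs]

/-! ### Circle identities at the hole -/

/-- `unitC (i p) = e^{iπ/2} unitC p` (`p ≠ 0`). [folklore] -/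
theorem unitC_I_mul {p : ℂ} (hp : p ≠ 0) : unitC (I * p) = Circle.exp (π / 2) * unitC p := by
  apply Subtype.ext
  rw [Circle.coe_mul, coe_unitC (mul_ne_zero I_ne_zero hp), coe_unitC hp, Circle.coe_exp]
  have hI : cexp (((π / 2 : ℝ) : ℂ) * I) = I := by
    rw [show ((π / 2 : ℝ) : ℂ) * I = (π : ℂ) / 2 * I by push_cast; ring]; exact Complex.exp_pi_div_two_mul_I
  rw [hI, norm_mul, Complex.norm_I, one_mul]
  ring

/-- **The corner fibre factor is the clutching twist**: for `p ≠ 0` off the lift's blend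
(`rΛ₂ ≤ |p|`), `unitC p · e^{-iS′(p)} = e^{-2πi [im p > 0] τ̂_w(re p)}`. [folklore] -/
theorem unitC_mul_exp_neg_liftS (h12 : J.rΛ₁ < J.rΛ₂) {p : ℂ} (hp : p ≠ 0) (hfar : J.rΛ₂ ≤ ‖p‖) :
    unitC p * Circle.exp (-J.liftS p) =
      Circle.exp (-(2 * π * gLeft (I * p) * stepW J.wS p.re)) := by
  have hb : capBlend J.rΛ₁ J.rΛ₂ ‖p‖ = 1 :=
    Real.smoothTransition.one_of_one_le ((one_le_div (by linarith)).2 (by linarith))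
  rw [liftS, hb, one_mul]
  have hIp : I * p ≠ 0 := mul_ne_zero I_ne_zero hp
  have key := exp_holeLift_mul_I (w := J.wS) hIp
  have him : (I * p).im = p.re := by simp
  rw [him] at key
  apply Subtype.ext
  rw [Circle.coe_mul, coe_unitC hp, Circle.coe_exp, Circle.coe_exp]
  have hsplit : ((-(holeLift J.wS (I * p) - π / 2) : ℝ) : ℂ) * I =
      -((holeLift J.wS (I * p) : ℂ) * I) + (π : ℂ) / 2 * I := by push_cast; ring
  rw [hsplit, Complex.exp_add, Complex.exp_pi_div_two_mul_I, Complex.exp_neg, key]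
  have hneg : cexp (((-(2 * π * gLeft (I * p) * stepW J.wS p.re) : ℝ) : ℂ) * I) =
      (cexp (((2 * π * gLeft (I * p) * stepW J.wS p.re : ℝ) : ℂ) * I))⁻¹ := by
    rw [← Complex.exp_neg]; push_cast; ring_nf
  rw [hneg]
  have hp' : (‖p‖ : ℂ) ≠ 0 := by exact_mod_cast norm_ne_zero_iff.2 hp
  have hIp' : (‖I * p‖ : ℂ) ≠ 0 := by exact_mod_cast norm_ne_zero_iff.2 hIp
  have hE : cexp (((2 * π * gLeft (I * p) * stepW J.wS p.re : ℝ) : ℂ) * I) ≠ 0 := Complex.exp_ne_zero _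
  rw [norm_mul, Complex.norm_I, one_mul]
  field_simp

/-- The left indicator at `i p` is the indicator of `im p > 0`. [folklore] -/
theorem gLeft_I_mul (p : ℂ) : gLeft (I * p) = if 0 < p.im then 1 else 0 := by
  simp only [gLeft, mul_re, I_re, zero_mul, I_im, one_mul, zero_sub, neg_lt_zero]

/-- **The clutching twist from the hole coordinate**: `e^{-2πi [im p₀ > 0] τ̂_w(re p₀)} = Tw(n, s)`
(for `|s - 1| < 1/4` and depth `< 1`). [folklore] -/
theorem twist_eq_twistC {x : ThreeTorus} {s : ℝ} (hs : |s - 1| < 1 / 4) (he : J.depth x.1 < 1) :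
    Circle.exp (-(2 * π * gLeft (I * J.holeP0 x s) * stepW J.wS (J.holeP0 x s).re)) = J.twistC (J.lat x.2.1) s := by
  have hre : (J.holeP0 x s).re = J.lat x.2.1 - J.nj := by
    rw [holeP0, add_re, ofReal_re, mul_re, ofReal_re, ofReal_im, I_re, I_im]; ring
  have him : (J.holeP0 x s).im = (1 - J.depth x.1) * bxH * Real.tan (2 * π * (s - 1)) := by
    rw [holeP0, add_im, ofReal_im, mul_im, ofReal_re, ofReal_im, I_re, I_im]; ring
  rw [gLeft_I_mul, hre, him, twistC]
  have hπ := Real.pi_pos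
  obtain ⟨hs1, hs2⟩ := abs_lt.1 hs
  by_cases h1 : s ≤ 1
  · -- `tan ≤ 0`
    have htan : Real.tan (2 * π * (s - 1)) ≤ 0 := by
      rw [Real.tan_eq_sin_div_cos]
      exact div_nonpos_of_nonpos_of_nonneg (Real.sin_nonpos_of_nonpos_of_neg_pi_le (by nlinarith) (by nlinarith))
        (Real.cos_nonneg_of_mem_Icc ⟨by nlinarith, by nlinarith⟩)
    have : ¬ (0 < (1 - J.depth x.1) * bxH * Real.tan (2 * π * (s - 1))) := by
      intro h; have := bxH_pos; nlinarith [mul_nonneg (mul_nonneg (by linarith : (0:ℝ) ≤ 1 - J.depth x.1) bxH_pos.le) (neg_nonneg.2 htan)]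
    rw [if_neg this, if_pos h1]; simp
  · have htan : 0 < Real.tan (2 * π * (s - 1)) := Real.tan_pos_of_pos_of_lt_pi_div_two (by nlinarith) (by nlinarith)
    have : 0 < (1 - J.depth x.1) * bxH * Real.tan (2 * π * (s - 1)) := by
      have := bxH_pos; positivity
    rw [if_pos this, if_neg h1, mul_one]

/-! ### Agreement of the corner with the box shell (box mode) -/

/-- **The corner is the box shell in box mode**: flat sector `|s - 1| ≤ 19/100`, depth `< 1`,
`p₀ ≠ 0` off the lift's blend (`rΛ₂ ≤ |p₀|`, `rΛ₁ < rΛ₂`), box mode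
`0 ≤ |p₀| - ρ_b + e/c` (`0 < p₁`), and `y_h = c_Y`. [folklore] -/
theorem cornerP_eq_boxP (h12 : J.rΛ₁ < J.rΛ₂) (hp₁ : 0 < J.p₁) (hyh : J.yh = cY) {x : ThreeTorus} {s : ℝ}
    (hs : |s - 1| ≤ 19 / 100) (he : J.depth x.1 < 1) (hp : J.holeP0 x s ≠ 0) (hfar : J.rΛ₂ ≤ ‖J.holeP0 x s‖)
    (hbox : 0 ≤ ‖J.holeP0 x s‖ - J.ρbL + J.depth x.1 / J.cL) : J.cornerP x s = J.boxP x s := by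
  set p := J.holeP0 x s with hpdef
  have hWE : J.bendWE x s = (‖p‖, J.depth x.1) := by
    rw [bendWE]; exact fishBend_of_nonneg hp₁ (by exact hbox)
  obtain ⟨hY, hT⟩ := face_flat hs (J.depth x.1)
  have hf : unitC p * Circle.exp (-J.liftS p) = J.twistC (J.lat x.2.1) s := by
    rw [J.unitC_mul_exp_neg_liftS h12 hp hfar, hpdef]
    exact J.twist_eq_twistC (by have := abs_le.1 hs; exact abs_lt.2 ⟨by linarith [this.1], by linarith [this.2]⟩) he
  -- positions: `n_j + |p| re (p/|p|) = n`, `c_Y + |p| im (p/|p|) = y`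
  have hpos : ((‖p‖ : ℝ) : ℂ) * (unitC p : ℂ) = p := by
    rw [coe_unitC hp]; field_simp [norm_ne_zero_iff.2 hp]
  have hre : J.nj + ‖p‖ * ((unitC p : ℂ)).re = J.lat x.2.1 := by
    have := congrArg Complex.re hpos
    simp only [mul_re, ofReal_re, ofReal_im, zero_mul, sub_zero] at this
    rw [this, hpdef, holeP0, add_re, ofReal_re, mul_re, ofReal_re, ofReal_im, I_re, I_im]; ring
  have him : J.yh + ‖p‖ * ((unitC p : ℂ)).im = faceY (thetaV s) (J.depth x.1) := by
    have := congrArg Complex.im hpos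
    simp only [mul_im, ofReal_re, ofReal_im, zero_mul, add_zero] at this
    rw [this, hY, hyh, hpdef, holeP0, add_im, ofReal_im, mul_im, ofReal_re, ofReal_im, I_re, I_im]; ring
  simp only [cornerP, boxP, hWE, hT]
  rw [← hpdef, mul_assoc x.2.2, hf, hre, him]

/-! ### Agreement of the hole with the corner (handle mode) -/

/-- The disc coordinate and the offset through the polar data of `p₀`. [folklore] -/
theorem holeZeta_eq (x : ThreeTorus) (s : ℝ) :
    J.holeZeta x s = (J.cL : ℂ) * J.holeP0 x s * ((Circle.exp (-J.liftS (J.holeP0 x s)) * x.2.2 : Circle) : ℂ) := by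
  rw [holeZeta, Circle.coe_mul]; ring

/-- **The hole piece is the corner in handle mode**, provided the tube is on its leg window
with position the radius itself and the shear profile `μ_L = 1` there: `0 < c`, `p₀ ≠ 0`,
handle mode `|p₀| - ρ_b + e/c ≤ -p₁`. [folklore] -/
theorem holeP_eq_cornerP (hc : 0 < J.cL) (hp₁ : 0 < J.p₁) {x : ThreeTorus} {s : ℝ} (hp : J.holeP0 x s ≠ 0)
    (hhandle : ‖J.holeP0 x s‖ - J.ρbL + J.depth x.1 / J.cL ≤ -J.p₁)
    (htube : ∀ a b : ℝ, J.tubeD (J.holeZeta x s, a, b) =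
      pieceU1 J.hε J.hε2 J.nj J.yh J.cL J.ρbL J.μL (‖J.holeZeta x s‖, arg (J.holeZeta x s), a, b))
    (hμ : J.μL ‖J.holeZeta x s‖ = 1) : J.holeP x s = J.cornerP x s := by
  set p := J.holeP0 x s with hpdef
  set W := (J.bendWE x s).1 with hWdef
  set g : Circle := Circle.exp (-J.liftS p) * x.2.2 with hg
  have hWE : J.bendWE x s = (J.ρbL - J.depth x.1 / J.cL, J.cL * (‖p‖ - J.ρbL) + 2 * J.depth x.1) := by
    rw [bendWE]; exact fishBend_of_le hc.ne' hp₁ (by exact hhandle)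
  have hW : W = J.ρbL - J.depth x.1 / J.cL := by rw [hWdef, hWE]
  -- the polar data of `ζ = c p g`
  have hζ : J.holeZeta x s = (J.cL : ℂ) * p * (g : ℂ) := J.holeZeta_eq x s
  have hg1 : ‖(g : ℂ)‖ = 1 := norm_eq_of_mem_sphere g
  have hnormζ : ‖J.holeZeta x s‖ = J.cL * ‖p‖ := by
    rw [hζ, norm_mul, norm_mul, hg1, mul_one, norm_real, Real.norm_of_nonneg hc.le]
  have hζ0 : J.holeZeta x s ≠ 0 := by
    rw [← norm_pos_iff, hnormζ]; exact mul_pos hc (norm_pos_iff.2 hp)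
  have hdir : exp (arg (J.holeZeta x s) * I) = (unitC p : ℂ) * g := by
    have h1 : exp (arg (J.holeZeta x s) * I) = J.holeZeta x s / ‖J.holeZeta x s‖ := by
      have h := norm_mul_exp_arg_mul_I (J.holeZeta x s)
      have hn : (‖J.holeZeta x s‖ : ℂ) ≠ 0 := by exact_mod_cast (norm_ne_zero_iff.2 hζ0)
      field_simp; rw [mul_comm]; exact h
    rw [h1, hnormζ, hζ, coe_unitC hp]
    have hc' : (J.cL : ℂ) ≠ 0 := by exact_mod_cast hc.ne'
    have hp' : (‖p‖ : ℂ) ≠ 0 := by exact_mod_cast (norm_ne_zero_iff.2 hp)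
    push_cast; field_simp
  -- the offset `w = W e^{iS′} z̄₃ = W ḡ`, so `e^{i arg ζ} w = W (p/|p|)`
  have hw : J.holeW x s = (W : ℂ) * ((g⁻¹ : Circle) : ℂ) := by
    rw [holeW, hg, mul_inv, Circle.coe_mul, ← Circle.exp_neg, neg_neg, hWdef]; ring
  have hrot : exp (arg (J.holeZeta x s) * I) * (((J.holeW x s).re : ℂ) + (J.holeW x s).im * I) = (W : ℂ) * (unitC p : ℂ) := by
    rw [re_add_im, hw, hdir]
    have : (g : ℂ) * ((g⁻¹ : Circle) : ℂ) = 1 := by rw [← Circle.coe_mul, mul_inv_cancel, Circle.coe_one]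
    calc (unitC p : ℂ) * g * ((W : ℂ) * ((g⁻¹ : Circle) : ℂ)) = (W : ℂ) * (unitC p : ℂ) * ((g : ℂ) * ((g⁻¹ : Circle) : ℂ)) := by ring
      _ = (W : ℂ) * (unitC p : ℂ) := by rw [this, mul_one]
  have hnormw : Real.sqrt ((J.holeW x s).re ^ 2 + (J.holeW x s).im ^ 2) = W := by
    have h1 : (J.holeW x s).re ^ 2 + (J.holeW x s).im ^ 2 = ‖J.holeW x s‖ ^ 2 := by
      rw [Complex.sq_norm, Complex.normSq_apply]; ring
    have hW0 : 0 ≤ W := by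
      rw [hW]
      -- `ρ_b - e/c ≥ 0` follows from handle mode: `e/c ≤ ρ_b - |p| - p₁ ≤ ρ_b`
      have := norm_nonneg p; linarith
    rw [h1, Real.sqrt_sq (norm_nonneg _), hw, norm_mul, norm_real, Real.norm_of_nonneg hW0,
      norm_eq_of_mem_sphere, mul_one]
  -- evaluate the leg tube
  have hbase : legT J.μL J.cL J.ρbL (J.cL * ‖p‖) W = 1 + (J.bendWE x s).2 * bxH := by
    rw [legT, ← hnormζ, hμ, hWE, hW, hnormζ]
    simp only
    field_simp
    ring
  rw [holeP, htube, pieceU1, legTubeMap]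
  simp only
  rw [hrot, hnormw, hnormζ, hbase, cornerP]
  simp only [physX, mtCoord, physAssemble_apply]
  congr 1
  -- the `T³` points
  have hf : Circle.exp (arg (J.holeZeta x s)) = x.2.2 * unitC p * Circle.exp (-J.liftS p) := by
    apply Subtype.ext
    rw [Circle.coe_exp, hdir, hg, Circle.coe_mul, Circle.coe_mul, Circle.coe_mul]
    ring
  simp only [expT]
  refine congrArg₂ _ (Prod.ext ?_ (Prod.ext ?_ ?_)) rfl
  · show Circle.exp _ = _
    simp only [Matrix.cons_val_zero]
    rw [sub_eq_add_neg, Circle.exp_add, Circle.exp_neg, hf, ← hpdef, ← hWdef]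
    simp [mul_re]
  · show Circle.exp _ = _
    simp only [Matrix.cons_val_one, Matrix.cons_val_zero]
    rw [← hpdef, ← hWdef]
    simp [mul_im]
  · show Circle.exp _ = _
    simp only [Matrix.cons_val]
    rw [← hpdef]
    exact hf

end IotaData

end Literature.Topology.FourManifolds
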